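import Summits.QuantumFields.BalabanUV.T4Continuum.Support.B13TermHistEnvelopeWitness
import Summits.QuantumFields.BalabanUV.T4Continuum.Support.B13TermOpSecant

/-!
# NE5 ∕ U3 — W2 OPERATOR half at activity level: NON-VACUITY WITNESS for route P2's producer
# `B13TermOpSecant.opLipschitz_b13_of_actOpLip` (one-polymer Ursell family `exp(o + h)` on the lineage's BASED toy model), and
# NEGATIVE CONTROLS (the unbased secant toy violates `ActOpBound` for every majorant, and `OpLipschitz` itself for every modulus)

Cell `pub-balaban`, unit `b2b-balaban-t4-ne5-formalise-leaf-03` (NE5 formalisation swarm, LEAF PROVER 03, gen 4; the O2 twin of the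
lineage's `Support/B13TermHistSecantWitness.lean` p210325 (history SECANT face, N64) and `Support/B13TermHistEnvelopeWitness.lean`
p212126 (history CAUCHY face, N78), fired through route P2's `Support/B13TermOpSecant.lean` p212487 (unit `b2b-balaban-t4-ne5-p2`,
gen 18, A7)).  Summits-side bookkeeping under the LEAN PLACEMENT RULE.  A TOY — nothing of [Balaban1988RG2Cluster] is modelled; no new
definition (the toy objects `oneIndexing`, `topInc`, `toyModel`, `boxModel`, `toyAct` are the tree's).  HONEST FRAMING: rung (B)+1 of the
FINITE-VOLUME T⁴ programme — NOT infinite volume, NOT a mass gap, NOT the Clay problem, NOT NE5 (NOT PRINTED; GAPS G-t4-U3-1), and NOT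
the wall W2-op (G-ne5p1-1′): the producer's termwise binders `ActOpBound`∕`ActOpLip` stay DISPLAYED for the (2.14)-terms of [II]; this
file only shows they are JOINTLY SATISFIABLE by a genuinely operator-dependent activity and that the producer then fires BY NAME.
HONEST DEPENDENCY (cell line, verbatim): continuum YM on T⁴ ⇐ BetaPertH ∧ nine spine estimates (0/9 proved); BetaPertH ⇐ (D1) ∧ (D4) ∧
CAP+tail; G-an2-4 gates asym, D1 and NE2/3/4.

WHAT.  On the based toy `B13TermHistEnvelopeWitness.boxModel` (output `exp(o + h)` as the one-polymer Ursell series over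
`B13TermHistSecantWitness.oneIndexing`∕`topInc`, base `B̄(0,1) × B̄(0,1)`, unit margins) and any reach `0 ≤ ρ₀ ≤ 1`:
* `box_actOpBound` — `ActOpBound oneIndexing toyAct boxModel univ ρ₀ (A ≡ e³)`: at a base point `‖p.1‖, ‖p.2‖ ≤ 1` and an operator datum
  `‖o − p.1‖ ≤ ρ₀ ≤ 1`, `‖e^{o + p.2}‖ = e^{Re(o + p.2)} ≤ e³`;
* `box_actOpLip` — `ActOpLip oneIndexing toyAct boxModel univ ρ₀ (N ≡ 2) (A ≡ e³)`: `‖e^{o+p.2} − e^{p.1+p.2}‖ = ‖e^{p.1+p.2}‖·‖e^{o−p.1} − 1‖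
  ≤ e²·2‖o − p.1‖ ≤ 2·(‖o − p.1‖∕1)·e³` (Mathlib's `Complex.norm_exp_sub_one_le` on `‖o − p.1‖ ≤ 1`);
* `box_opConv`, `box_opBudget` — d3's convergence binder over the one-point index and the secant budget `Σ'ᵢ secMajorant (N ≡ 2) (A ≡ e³)
  = 2e³ ≤ 2e³·e^{−0·d(X)}`;
* **`toy_opLipschitz : OpLipschitz boxModel univ 0 (2·e³) ρ₀`** — route P2's `opLipschitz_b13_of_actOpLip` APPLIED BY NAME (`hM := rfl`),
  every binder discharged with the explicit data above; read back (`toy_opReading`): for `‖o₀‖, ‖h‖ ≤ 1` and `‖o − o₀‖ ≤ ρ₀`,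
  `‖e^{o+h} − e^{o₀+h}‖ ≤ 2e³·‖o − o₀‖` (the optimal modulus on that region is `e^{2+ρ₀}`: the producer is within the factor `2e^{1−ρ₀}`);
* NEGATIVE CONTROL **`not_actOpBound_toyModel`**: on the UNBASED secant toy `B13TermHistSecantWitness.toyModel` (`Base := univ`, on which
  the lineage's history secant face N64 DID fire) the binder `ActOpBound` FAILS for EVERY majorant family `A` and every reach (base point
  `p = (|A| + 1, 0)`, `o = p.1`: `‖e^{p.1}‖ = e^{|A|+1} > |A| ≥ A`) — the operator half needs the base's bound on the OPERATOR coordinate,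
  which the history half did not (there the class bounded the inputs); and **`not_opLipschitz_toyModel`**: the END's binder
  `OpLipschitz toyModel univ 0 Λ ρ₀` ITSELF fails there for every `Λ` and every `ρ₀ > 0` — base-boundedness in the operator coordinate
  is NECESSARY for W2-op, not only for route P2's sufficient condition.
0 sorry; axioms ⊆ {propext, Classical.choice, Quot.sound}.
-/

noncomputable section

open MeasureTheory Metric Set
open scoped BigOperators

namespace Summit.QuantumFields.BalabanUV.T4Continuum.B13TermOpSecantWitness

open Literature.MathematicalPhysics.QuantumFieldTheory.Balaban1983to89.T4OutputRate (Carriers)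
open Literature.MathematicalPhysics.QuantumFieldTheory.Balaban1983to89.T4InputCauchyRate (toyCarriers)
open Literature.MathematicalPhysics.QuantumFieldTheory.Balaban1983to89.T4InputCauchyRateData (StepModel)
open Literature.MathematicalPhysics.QuantumFieldTheory.Balaban1983to89.T4InputCauchyRateSpecies (OpLipschitz)
open Summit.QuantumFields.BalabanUV.T4Continuum.B13StepTermFamily (toyAct)
open Summit.QuantumFields.BalabanUV.T4Continuum.B13TermRep (actMajorant)
open Summit.QuantumFields.BalabanUV.T4Continuum.B13TermHistSecant (secMajorant)
open Summit.QuantumFields.BalabanUV.T4Continuum.B13TermHistSecantWitness (oneIndexing topInc toyModel coeff_one)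
open Summit.QuantumFields.BalabanUV.T4Continuum.B13TermHistEnvelopeWitness (boxModel box_actMajorant out_eq)
open Summit.QuantumFields.BalabanUV.T4Continuum.B13TermOpSecant (ActOpBound ActOpLip opLipschitz_b13_of_actOpLip)

/-! ## §1 The displayed binders of the operator-half producer hold on the based toy -/

/-- [folklore] A base point of the based toy has both coordinates in the closed unit ball. -/
theorem mem_base {k : ℕ} {g : ℕ → ℝ} {U : toyCarriers.BgB} {p : ℂ × ℂ} (hp : p ∈ boxModel.Base k g U) :
    ‖p.1‖ ≤ 1 ∧ ‖p.2‖ ≤ 1 := by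
  obtain ⟨h1, h2⟩ := Set.mem_prod.1 hp
  exact ⟨mem_closedBall_zero_iff.1 h1, mem_closedBall_zero_iff.1 h2⟩

/-- [folklore] Within reach `ρ₀ ≤ 1` of a base point (operator margin `rOp ≡ 1`) the operator datum has norm `≤ 2`. -/
theorem norm_le_two_of_reach {ρ₀ : ℝ} (hρ₁ : ρ₀ ≤ 1) {k : ℕ} {p : ℂ × ℂ} (hp1 : ‖p.1‖ ≤ 1) {o : ℂ}
    (ho : ‖o - p.1‖ ≤ ρ₀ * boxModel.rOp k) : ‖o‖ ≤ 2 := by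
  have hr : boxModel.rOp k = 1 := rfl
  rw [hr, mul_one] at ho
  calc ‖o‖ = ‖(o - p.1) + p.1‖ := by rw [sub_add_cancel]
    _ ≤ ‖o - p.1‖ + ‖p.1‖ := norm_add_le _ _
    _ ≤ 1 + 1 := add_le_add (ho.trans hρ₁) hp1
    _ = 2 := by norm_num

/-- [folklore] **`ActOpBound` ON THE BASED TOY** with the constant majorant `A ≡ e³`: `‖e^{o + p.2}‖ = e^{Re o + Re p.2} ≤ e^{2+1}`. -/
theorem box_actOpBound {ρ₀ : ℝ} (hρ₁ : ρ₀ ≤ 1) :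
    ActOpBound oneIndexing toyAct boxModel Set.univ ρ₀ fun _ _ _ _ _ => Real.exp 3 := by
  intro k g _ U p hp o ho X _ i _ m
  obtain ⟨hp1, hp2⟩ := mem_base hp
  have ho2 := norm_le_two_of_reach hρ₁ hp1 ho
  show ‖Complex.exp (o + p.2)‖ ≤ Real.exp 3
  rw [Complex.norm_exp, Complex.add_re]
  exact Real.exp_le_exp.2 (by linarith [(Complex.re_le_norm o).trans ho2, (Complex.re_le_norm p.2).trans hp2])

/-- [folklore] **`ActOpLip` ON THE BASED TOY** with modulus `N ≡ 2` against `A ≡ e³`: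
`‖e^{o+p.2} − e^{p.1+p.2}‖ = ‖e^{p.1+p.2}‖·‖e^{o−p.1} − 1‖ ≤ e²·(2‖o − p.1‖) ≤ 2·(‖o − p.1‖∕rOp)·e³`. -/
theorem box_actOpLip {ρ₀ : ℝ} (hρ₁ : ρ₀ ≤ 1) :
    ActOpLip oneIndexing toyAct boxModel Set.univ ρ₀ (fun _ _ _ _ _ => 2) fun _ _ _ _ _ => Real.exp 3 := by
  intro k g _ U p hp o ho X _ i _ m
  obtain ⟨hp1, hp2⟩ := mem_base hp
  have hr : boxModel.rOp k = 1 := rfl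
  have hd : ‖o - p.1‖ ≤ 1 := by rw [hr, mul_one] at ho; exact ho.trans hρ₁
  show ‖Complex.exp (o + p.2) - Complex.exp (p.1 + p.2)‖ ≤ 2 * (‖o - p.1‖ / boxModel.rOp k) * Real.exp 3
  have hfac : Complex.exp (o + p.2) - Complex.exp (p.1 + p.2) = Complex.exp (p.1 + p.2) * (Complex.exp (o - p.1) - 1) := by
    rw [mul_sub, mul_one, ← Complex.exp_add]; congr 1; ring
  have hbase : ‖Complex.exp (p.1 + p.2)‖ ≤ Real.exp 2 := by
    rw [Complex.norm_exp, Complex.add_re]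
    exact Real.exp_le_exp.2 (by linarith [(Complex.re_le_norm p.1).trans hp1, (Complex.re_le_norm p.2).trans hp2])
  have h23 : Real.exp 2 ≤ Real.exp 3 := Real.exp_le_exp.2 (by norm_num)
  rw [hfac, norm_mul, hr, div_one]
  calc ‖Complex.exp (p.1 + p.2)‖ * ‖Complex.exp (o - p.1) - 1‖ ≤ Real.exp 2 * (2 * ‖o - p.1‖) :=
        mul_le_mul hbase (Complex.norm_exp_sub_one_le hd) (norm_nonneg _) (Real.exp_pos 2).le
    _ ≤ Real.exp 3 * (2 * ‖o - p.1‖) := mul_le_mul_of_nonneg_right h23 (by positivity)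
    _ = 2 * ‖o - p.1‖ * Real.exp 3 := by ring

/-- [folklore] d3's CONVERGENCE binder on the toy: the one-point index is summable. -/
theorem box_opConv : ∀ k, ∀ g ∈ (Set.univ : Set (ℕ → ℝ)), ∀ (U : toyCarriers.BgB) (X : toyCarriers.Dom), toyCarriers.scale X = k →
    Summable (actMajorant oneIndexing topInc
      ((fun (_ : ℕ) (_ : ℕ → ℝ) (_ : toyCarriers.BgB) (_ : Unit) (_ : Unit) => Real.exp 3) k g U) k X) :=
  fun _ _ _ _ _ _ => Summable.of_finite

/-- [folklore] The induced combinatorial majorant is the constant `e³` at step-`k` domains. -/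
theorem box_actMajorant₃ {k : ℕ} {X : toyCarriers.Dom} (hX : toyCarriers.scale X = k) (i : Unit) :
    actMajorant oneIndexing topInc (fun _ _ => Real.exp 3) k X i = Real.exp 3 := by
  rw [B13TermRep.actMajorant_of_rel (show oneIndexing.Rel k i X from hX), coeff_one, norm_one, one_mul]
  exact Fin.prod_univ_one _

/-- [folklore] The induced secant majorant is the constant `2e³` (one factor, `N = 2`). -/
theorem box_secMajorant {k : ℕ} {X : toyCarriers.Dom} (hX : toyCarriers.scale X = k) (i : Unit) :
    secMajorant oneIndexing topInc (fun _ _ => (2 : ℝ)) (fun _ _ => Real.exp 3) k X i = 2 * Real.exp 3 := by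
  rw [secMajorant, box_actMajorant₃ hX]
  show (∑ _m : Fin (0 + 1), (2 : ℝ)) * Real.exp 3 = 2 * Real.exp 3
  simp

/-- [folklore] THE SECANT BUDGET at rate `0`: `Σ'ᵢ secMajorant = 2e³ ≤ 2e³·e^{−0·d(X)}` (the SAME budget shape as the history face's). -/
theorem box_opBudget : ∀ k, ∀ g ∈ (Set.univ : Set (ℕ → ℝ)), ∀ (U : toyCarriers.BgB) (X : toyCarriers.Dom), toyCarriers.scale X = k →
    Summable (secMajorant oneIndexing topInc ((fun (_ : ℕ) (_ : ℕ → ℝ) (_ : toyCarriers.BgB) (_ : Unit) (_ : Unit) => (2 : ℝ)) k g U)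
      ((fun (_ : ℕ) (_ : ℕ → ℝ) (_ : toyCarriers.BgB) (_ : Unit) (_ : Unit) => Real.exp 3) k g U) k X) ∧
      ∑' i, secMajorant oneIndexing topInc ((fun (_ : ℕ) (_ : ℕ → ℝ) (_ : toyCarriers.BgB) (_ : Unit) (_ : Unit) => (2 : ℝ)) k g U)
        ((fun (_ : ℕ) (_ : ℕ → ℝ) (_ : toyCarriers.BgB) (_ : Unit) (_ : Unit) => Real.exp 3) k g U) k X i ≤
        2 * Real.exp 3 * Real.exp (-(0 * toyCarriers.d X)) := by
  intro k g _ U X hX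
  refine ⟨Summable.of_finite, ?_⟩
  rw [tsum_fintype, Fintype.sum_unique, box_secMajorant hX, zero_mul, neg_zero, Real.exp_zero, mul_one]

/-! ## §2 The producer fires BY NAME; the conclusion read back -/

/-- [folklore] **ROUTE P2's OPERATOR-HALF PRODUCER FIRES ON THE BASED TOY**: for any reach `0 ≤ ρ₀ ≤ 1`, `ActOpBound (A ≡ e³)`,
`ActOpLip (N ≡ 2, A ≡ e³)`, d3 convergence and the secant budget `2e³` at rate `0` ⟹ `OpLipschitz boxModel univ 0 (2e³) ρ₀` —
`B13TermOpSecant.opLipschitz_b13_of_actOpLip` with `hM := rfl` and every binder discharged by §1's explicit data. -/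
theorem toy_opLipschitz {ρ₀ : ℝ} (hρ₀ : 0 ≤ ρ₀) (hρ₁ : ρ₀ ≤ 1) : OpLipschitz boxModel Set.univ 0 (2 * Real.exp 3) ρ₀ :=
  opLipschitz_b13_of_actOpLip (𝒯 := oneIndexing) (inc := topInc) (act := toyAct) (M := boxModel) (fun _ _ _ _ => rfl) hρ₀
    (fun _ _ _ _ _ => (Real.exp_pos 3).le) (fun _ _ _ _ _ => zero_le_two) (box_actOpBound hρ₁) (box_actOpLip hρ₁) box_opConv
    box_opBudget

/-- [folklore] **READING THE CONCLUSION** (non-triviality): for a base point `‖o₀‖, ‖h‖ ≤ 1` and an operator datum within reach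
`‖o − o₀‖ ≤ ρ₀ ≤ 1`, `‖e^{o+h} − e^{o₀+h}‖ ≤ 2e³·‖o − o₀‖` — a genuine Lipschitz bound in the OPERATOR coordinate (optimal constant on
this region `e^{2+ρ₀}`). -/
theorem toy_opReading {ρ₀ : ℝ} (hρ₀ : 0 ≤ ρ₀) (hρ₁ : ρ₀ ≤ 1) {o₀ o h : ℂ} (ho₀ : ‖o₀‖ ≤ 1) (hh : ‖h‖ ≤ 1) (ho : ‖o - o₀‖ ≤ ρ₀) :
    ‖Complex.exp (o + h) - Complex.exp (o₀ + h)‖ ≤ 2 * Real.exp 3 * ‖o - o₀‖ := by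
  have hp : ((o₀, h) : ℂ × ℂ) ∈ boxModel.Base 0 (fun _ => 0) () :=
    Set.mk_mem_prod (mem_closedBall_zero_iff.2 ho₀) (mem_closedBall_zero_iff.2 hh)
  have hr : boxModel.rOp 0 = 1 := rfl
  have hoR : ‖o - ((o₀, h) : ℂ × ℂ).1‖ ≤ ρ₀ * boxModel.rOp 0 := by rw [hr, mul_one]; exact ho
  have key := toy_opLipschitz hρ₀ hρ₁ 0 (fun _ => 0) (Set.mem_univ _) () (o₀, h) hp (0 : ℕ) rfl o hoR
  have hd : toyCarriers.d (0 : ℕ) = 0 := rfl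
  rw [out_eq (k := 0) (X := (0 : ℕ)) rfl, out_eq (k := 0) (X := (0 : ℕ)) rfl, hr, hd, div_one, mul_zero, neg_zero,
    Real.exp_zero, mul_one] at key
  exact key

/-! ## §3 Negative control: the UNBASED secant toy violates `ActOpBound` -/

/-- [folklore] **THE OPERATOR HALF NEEDS A BOUNDED BASE.**  On the lineage's unbased secant toy `toyModel` (`Base := univ`, margins 1 —
the model on which the HISTORY secant face `B13TermHistSecantWitness.toy_histSecant` fired) the producer's first binder `ActOpBound`
FAILS for EVERY majorant family `A` and every reach `ρ₀ ≥ 0`: at the base point `p = (|A k g U| + 1, 0)` and `o = p.1` the factor is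
`e^{|A|+1} > |A| ≥ A`. -/
theorem not_actOpBound_toyModel {ρ₀ : ℝ} (hρ₀ : 0 ≤ ρ₀) (A : ℕ → (ℕ → ℝ) → toyCarriers.BgB → Unit → Unit → ℝ) :
    ¬ ActOpBound oneIndexing toyAct toyModel Set.univ ρ₀ A := by
  intro h
  set a : ℝ := A 0 (fun _ => 0) () () () with ha
  have hp : (((|a| + 1 : ℝ) : ℂ), (0 : ℂ)) ∈ toyModel.Base 0 (fun _ => 0) () := Set.mem_univ _
  have ho : ‖((|a| + 1 : ℝ) : ℂ) - ((((|a| + 1 : ℝ) : ℂ), (0 : ℂ)) : ℂ × ℂ).1‖ ≤ ρ₀ * toyModel.rOp 0 := by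
    rw [sub_self, norm_zero]; exact mul_nonneg hρ₀ (toyModel.rOp_pos 0).le
  have key := h 0 (fun _ => 0) (Set.mem_univ _) () _ hp _ ho (0 : ℕ) rfl () rfl 0
  change ‖Complex.exp (((|a| + 1 : ℝ) : ℂ) + 0)‖ ≤ a at key
  rw [add_zero, Complex.norm_exp, Complex.ofReal_re] at key
  have h1 : |a| + 1 < Real.exp (|a| + 1) := by linarith [Real.add_one_lt_exp (show |a| + 1 ≠ 0 by positivity)]
  linarith [le_abs_self a]

/-- [folklore] **… AND SO DOES THE WALL ITSELF**: on the unbased secant toy the END's operator-half binder `OpLipschitz toyModel univ 0 Λ ρ₀`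
is FALSE for EVERY modulus `Λ` and every positive reach `ρ₀` (base point `p = (|Λ| + 1, 0)`, `o = p.1 + ρ₀`:
`‖e^{p.1+ρ₀} − e^{p.1}‖ = e^{p.1}(e^{ρ₀} − 1) ≥ e^{|Λ|+1}·ρ₀ > Λ·ρ₀`) — a bound on the OPERATOR coordinate of the base is NECESSARY for
W2-op, not merely for route P2's sufficient condition.  (For `ρ₀ = 0` the shape is trivially true: `o = p.1`.) -/
theorem not_opLipschitz_toyModel {ρ₀ : ℝ} (hρ₀ : 0 < ρ₀) (Λ : ℝ) : ¬ OpLipschitz toyModel Set.univ 0 Λ ρ₀ := by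
  intro h
  set t : ℝ := |Λ| + 1 with ht
  have hp : ((((t : ℝ) : ℂ)), (0 : ℂ)) ∈ toyModel.Base 0 (fun _ => 0) () := Set.mem_univ _
  have hnorm : ‖((t + ρ₀ : ℝ) : ℂ) - ((t : ℝ) : ℂ)‖ = ρ₀ := by
    rw [← Complex.ofReal_sub, Complex.norm_real, add_sub_cancel_left, Real.norm_eq_abs, abs_of_pos hρ₀]
  have hr : toyModel.rOp 0 = 1 := rfl
  have ho : ‖((t + ρ₀ : ℝ) : ℂ) - ((((t : ℝ) : ℂ), (0 : ℂ)) : ℂ × ℂ).1‖ ≤ ρ₀ * toyModel.rOp 0 := by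
    rw [hr, mul_one]; exact hnorm.le
  have key := h 0 (fun _ => 0) (Set.mem_univ _) () _ hp (0 : ℕ) rfl _ ho
  have hd : toyCarriers.d (0 : ℕ) = 0 := rfl
  rw [B13TermHistSecantWitness.out_eq (k := 0) (X := (0 : ℕ)) rfl, B13TermHistSecantWitness.out_eq (k := 0) (X := (0 : ℕ)) rfl,
    hr, hd, div_one, mul_zero, neg_zero, Real.exp_zero, mul_one] at key
  change ‖Complex.exp (((t + ρ₀ : ℝ) : ℂ) + 0) - Complex.exp (((t : ℝ) : ℂ) + 0)‖ ≤ Λ * ‖((t + ρ₀ : ℝ) : ℂ) - ((t : ℝ) : ℂ)‖ at key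
  rw [hnorm, add_zero, add_zero, ← Complex.ofReal_exp, ← Complex.ofReal_exp, ← Complex.ofReal_sub, Complex.norm_real,
    Real.norm_eq_abs, Real.exp_add] at key
  have het : |Λ| + 1 < Real.exp t := by
    have := Real.add_one_lt_exp (show t ≠ 0 by positivity); linarith
  have h1 : Λ * ρ₀ ≤ |Λ| * ρ₀ := mul_le_mul_of_nonneg_right (le_abs_self Λ) hρ₀.le
  have h2 : |Λ| * ρ₀ < Real.exp t * ρ₀ := mul_lt_mul_of_pos_right (by linarith) hρ₀
  have h3 : Real.exp t * ρ₀ ≤ Real.exp t * Real.exp ρ₀ - Real.exp t := by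
    rw [← mul_sub_one]; exact mul_le_mul_of_nonneg_left (by linarith [Real.add_one_le_exp ρ₀]) (Real.exp_pos t).le
  have h4 : Real.exp t * Real.exp ρ₀ - Real.exp t ≤ |Real.exp t * Real.exp ρ₀ - Real.exp t| := le_abs_self _
  linarith

end Summit.QuantumFields.BalabanUV.T4Continuum.B13TermOpSecantWitness

end
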